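import Summits.HodgeConjecture.HodgeConjecture.Theorems.F0P3HJ3aOfFiveLetters
import Summits.HodgeConjecture.HodgeConjecture.Theorems.F0P2aCohIsotypicLineHolds
import HarnessLib

/-!
# Crux `H413` — `hJ3a` (row III-J3a) and `H413` FROM FOUR PRINTED-CITATION LETTERS {E1, E1′hol, E2′, (D)hol}: letter (E)hol
# `CotangentForms.cohIsotypicLine_hol` is now a TREE THEOREM and is folded BY NAME

Floor-0 programme P3 «U3-mult», seat F0P3-p04 (g3); crux item stmt-HodgeConjecture-24833 (`HCCMUnconditional.H413`); line
`Cruxes/H413/Lines/F0_U3CohMultOne.lean` v1.4 (HEAD 3′ `hJ3a_of_five_letters`).  HC_CM is proved only modulo the printed citations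
until rung 0 closes.  THEOREMS ONLY (no definition, no named fact, no `sorry`).

The five-letter head ★ `HJ3aOfFiveLetters.hJ3a_of_five_letters` (F0P3-p04 (g2), p795655) takes (E)hol = the Literature letter
`UnitaryGroup.CotangentForms.cohIsotypicLine_hol` («inside one discrete `P`, the equivariant holomorphic-cotangent-valued maps out of an
irreducible smooth `σ` with classes in `P` lie on one line») as a hypothesis.  Programme P2a's line `Cruxes/H413/Lines/F0_P2aCohIsotypicLine`
(ED. 4, sorry-free) PROVED that letter outright: ★ `F0P2aCohIsotypicLineHolds.cohIsotypicLine_hol_holds : CotangentForms.cohIsotypicLine_hol`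
(F0P2a-p01, part II; from S1 sesquilinear Schur, S2⁺ archimedean orthogonality of the cuts L2a–L2e, S2β continuity, S3 admissibility of
coh-valued `σ`).  This file substitutes it BY NAME: row III-J3a and the crux are theorems modulo the FOUR letters E1
`Rogawski1990.innerFormMultiplicityLeOne`, E1′hol `Rogawski1990.cohFinComponentUnique_hol`, E2′ `Rogawski1990.hodgeTypeRigid`, (D)hol
`CotangentForms.holCotFormSpectralProjection` (the last is the socket of programme P2's line `F0_P2SpectralProjectionD`, stubs K∕S∕R open,
H∕G∕T ★; E1′hol ⇐ E1 + F1a + F1b′ is this seat's rung-1 road, `F0/P3/STATUS.md` 2026-08-31T00:28Z).  Conclusions VERBATIM as in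
`F0P3HJ3aOfFiveLetters` (= floor V7 ll. 76–80 for `hJ3a`; the crux decl by name for `H413`, the two other floor rows as the explicit
hypotheses `hdictE` ∕ `hocc`).

References: [Liu2021] Prop. 4.13 and proof l. 2121–2146, Lem. D.2 (2); [Rogawski1990] Thm. 14.6.4, §15.3 ¶1, Prop. 15.2.1 (b);
[BorelWallach2000] VI 4.11, VII 3.2.
-/

-- the mandated namespace repeats `HodgeConjecture.HodgeConjecture`, as in every `Theorems/*.lean` of this sub-problem
set_option linter.dupNamespace false

noncomputable section

namespace Summit.HodgeConjecture.HodgeConjecture.Cruxes.H413.HJ3aOfFourLetters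

open scoped TensorProduct Matrix
open NumberField NumberField.InfinitePlace IsDedekindDomain
open HodgeCM.Model HodgeCM.Model.LiuIndex HodgeCM.Model.TowerCarrier
open Summit.HodgeConjecture.CorCM.Model
open Literature.AlgebraicGeometry.Motives (CMType AbelianVariety)
open Literature.AlgebraicGeometry.HodgeTheory Literature.NumberTheory.Automorphic.PicardCM
open Literature.AlgebraicGeometry.ShimuraVarieties Literature.AlgebraicGeometry.ShimuraVarieties.UnitaryCanonicalModel
open Literature.NumberTheory.ComplexMultiplication
open Literature.NumberTheory.Automorphic
open Literature.NumberTheory.Automorphic.Liu2021 Literature.NumberTheory.Automorphic.Liu2021.AppendixC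
open Literature.NumberTheory.Automorphic.Liu2021.Def411WeilCarriers (lineOf locF Rep)
open Summit.HodgeConjecture.CorCM.Transposition.OmegaTransport (realUnit)
open HodgeCM.Model.ArchSideTerm (e₁)
open Literature.NumberTheory.GelbartRogawski1991 Literature.NumberTheory.GelbartRogawski1991.UnitaryDualPair
open Literature.RepresentationTheory Literature.RepresentationTheory.Liu2021
open Summit.HodgeConjecture.CorCM
open Summit.HodgeConjecture.CorCM.Transposition
open Literature.NumberTheory.GelbartRogawski1991.OscillatorTripleDictionary (OccursInH1 IsIsoToOmega)
open Summit.HodgeConjecture.CorCM.Lines.A3Liu418 (Thm415AtFace EpsRigidAtFace)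
open Summit.HodgeConjecture.HodgeConjecture.Theses (HCCMUnconditional.HDel)
open MulAction
open Literature.Geometry.ComplexHyperbolic.BallModel (U21 x₀)
open Literature.NumberTheory.GelbartRogawski1991.OscillatorTripleDictionary (rhoTriple)
open Summit.HodgeConjecture.CorCM.Lines.A3Liu413 (datum413)
open Summit.HodgeConjecture.HodgeConjecture.Cruxes.H413.CohFormsCarriers

set_option synthInstance.maxHeartbeats 400000 in
set_option maxHeartbeats 8000000 in
/-- **`hJ3a` FROM FOUR LETTERS** (row III-J3a of the floor: `rank_ℂ Hom_{U(V)(𝔸_{F⁺,f})}(ω_V(t), H¹_{B,τ'}) ≤ 1` for every face, `3 ≤ n`,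
`τ'`, `t`); conclusion = floor V7 ll. 76–80 VERBATIM.  Hypotheses: E1, E1′hol, E2′, (D)hol; (E)hol is ★
`F0P2aCohIsotypicLineHolds.cohIsotypicLine_hol_holds`, the `(0,1)`-type twins come by conjugation symmetry inside the five-letter head.
HC_CM is proved only modulo the printed citations until rung 0 closes.
[cite: Liu2021, proof of Prop. 4.13, l. 2121–2146; Lem. D.2 (2)] [cite: Rogawski1990, Thm. 14.6.4; §15.3 ¶1] [cite: BorelWallach2000, VI 4.11] -/
theorem hJ3a_of_four_letters (hE1 : Literature.NumberTheory.Rogawski1990.innerFormMultiplicityLeOne)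
    (hE1'h : Literature.NumberTheory.Rogawski1990.cohFinComponentUnique_hol)
    (hE2' : Literature.NumberTheory.Rogawski1990.hodgeTypeRigid)
    (hDh : Literature.NumberTheory.Automorphic.UnitaryGroup.CotangentForms.holCotFormSpectralProjection) :
    ∀ (hDel : Literature.AlgebraicGeometry.ShimuraVarieties.UnitaryCanonicalModel.canonicalModel_exists_printed)
    (F : HodgeCM.CMField) [IsGalois ℚ F] (h6 : 6 ≤ Module.finrank ℚ F) {ι₁ : F →+* ℂ} (V : HodgeCM.HermSpace3 F ι₁) (a₀ : RealScalar F)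
    (Φ : CMType F) (hΦ : ι₁ ∈ Φ.1) (i : (I V (repAt a₀) (muLiu ι₁ GramClass.rep))),
    (((uniformOmegaRep (Summit.HodgeConjecture.CorCM.DelRec.exists_recordSystem_of_printed hDel) ⟨HodgeCM.CMField.K F⟩ ι₁ ⟨HodgeCM.HermSpace3.Hm V, HodgeCM.HermSpace3.isHermitian V, HodgeCM.HermSpace3.signature_ι₁ V, HodgeCM.HermSpace3.posDef_of_ne V⟩ Φ e₁ (frameD V) (frameD_real V) (frameD_ne V) (ιVE V) (2 * imagUnit (HodgeCM.CMField.K F))⁻¹ (fun _ _ => (Rep.update ↥(maximalRealSubfield (HodgeCM.CMField.K F)) (imagUnitSq (HodgeCM.CMField.K F)) (Rep.ofLineOf ↥(maximalRealSubfield (HodgeCM.CMField.K F)) (imagUnitSq (HodgeCM.CMField.K F))) (locF ↥(maximalRealSubfield (HodgeCM.CMField.K F)) (imagUnitSq (HodgeCM.CMField.K F)) (realUnit ⟨HodgeCM.CMField.K F⟩ (repAt a₀ (Sigma.fst i)).1 (repAt a₀ (Sigma.fst i)).2.1 (repAt a₀ (Sigma.fst i)).2.2)) (realUnit ⟨HodgeCM.CMField.K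 F⟩ (repAt a₀ (Sigma.fst i)).1 (repAt a₀ (Sigma.fst i)).2.1 (repAt a₀ (Sigma.fst i)).2.2) rfl)))).prop413Data ((liuDictionaryPin exists_isReal_hodgeModel_holds hodgePQ_independent_of_hodgeModel_holds BallQuotient.ballQuotientUniformised_holds (cmAbelianVarietyRealised_of_eigenbasis exists_isReal_hodgeModel_holds hodgePQ_independent_of_hodgeModel_holds cmAbelianVarietyEigenbasisRealised_holds) Literature.NumberTheory.Transcendental.arapura2012_cor_15_4_6_holds V (I V (repAt a₀) (muLiu ι₁ GramClass.rep)) (line V (repAt a₀) (muLiu ι₁ GramClass.rep)))).H).multiplicity_le_one_printed :=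
  HJ3aOfFiveLetters.hJ3a_of_five_letters hE1 hE1'h hE2' hDh F0P2aCohIsotypicLineHolds.cohIsotypicLine_hol_holds

set_option synthInstance.maxHeartbeats 400000 in
set_option maxHeartbeats 8000000 in
/-- **THE CRUX `HCCMUnconditional.H413` BY NAME FROM FOUR LETTERS AND THE TWO OTHER FLOOR ROWS** (`hdictE` = row III-2 (a)′, `hocc` =
row III-2 (c)′, VERBATIM as in `HJ3aOfFiveLetters.H413_of_five_letters`). HC_CM is proved only modulo the printed citations until rung 0
closes. [cite: Liu2021, Prop. 4.13; Rem. 4.14] [cite: Rogawski1990, Thm. 14.6.4; §15.3] -/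
theorem H413_of_four_letters (hE1 : Literature.NumberTheory.Rogawski1990.innerFormMultiplicityLeOne)
    (hE1'h : Literature.NumberTheory.Rogawski1990.cohFinComponentUnique_hol)
    (hE2' : Literature.NumberTheory.Rogawski1990.hodgeTypeRigid)
    (hDh : Literature.NumberTheory.Automorphic.UnitaryGroup.CotangentForms.holCotFormSpectralProjection)
    (hdictE :
      ∀ (hDel : Literature.AlgebraicGeometry.ShimuraVarieties.UnitaryCanonicalModel.canonicalModel_exists_printed)
      (F : HodgeCM.CMField) [IsGalois ℚ F] (h6 : 6 ≤ Module.finrank ℚ F) {ι₁ : F →+* ℂ} (V : HodgeCM.HermSpace3 F ι₁) (a₀ : RealScalar F)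
      (Φ : CMType F) (hΦ : ι₁ ∈ Φ.1) (i : (I V (repAt a₀) (muLiu ι₁ GramClass.rep))),
      oscillatorTriple_dictionaryExistence (((uniformOmegaRep (Summit.HodgeConjecture.CorCM.DelRec.exists_recordSystem_of_printed hDel) ⟨HodgeCM.CMField.K F⟩ ι₁ ⟨HodgeCM.HermSpace3.Hm V, HodgeCM.HermSpace3.isHermitian V, HodgeCM.HermSpace3.signature_ι₁ V, HodgeCM.HermSpace3.posDef_of_ne V⟩ Φ e₁ (frameD V) (frameD_real V) (frameD_ne V) (ιVE V) (2 * imagUnit (HodgeCM.CMField.K F))⁻¹ (fun _ _ => (Rep.update ↥(maximalRealSubfield (HodgeCM.CMField.K F)) (imagUnitSq (HodgeCM.CMField.K F)) (Rep.ofLineOf ↥(maximalRealSubfield (HodgeCM.CMField.K F)) (imagUnitSq (HodgeCM.CMField.K F))) (locF ↥(maximalRealSubfield (HodgeCM.CMField.K F)) (imagUnitSq (HodgeCM.CMField.K F)) (realUnit ⟨HodgeCM.CMField.K F⟩ (repAt a₀ (Sigma.fst i)).1 (repAt a₀ (Sigma.fst i)).2.1 (repAt a₀ (Sigma.fst i)).2.2))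 (realUnit ⟨HodgeCM.CMField.K F⟩ (repAt a₀ (Sigma.fst i)).1 (repAt a₀ (Sigma.fst i)).2.1 (repAt a₀ (Sigma.fst i)).2.2) rfl)))).prop413Data ((liuDictionaryPin exists_isReal_hodgeModel_holds hodgePQ_independent_of_hodgeModel_holds BallQuotient.ballQuotientUniformised_holds (cmAbelianVarietyRealised_of_eigenbasis exists_isReal_hodgeModel_holds hodgePQ_independent_of_hodgeModel_holds cmAbelianVarietyEigenbasisRealised_holds) Literature.NumberTheory.Transcendental.arapura2012_cor_15_4_6_holds V (I V (repAt a₀) (muLiu ι₁ GramClass.rep)) (line V (repAt a₀) (muLiu ι₁ GramClass.rep)))).H))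
    (hocc :
      ∀ (hDel : Literature.AlgebraicGeometry.ShimuraVarieties.UnitaryCanonicalModel.canonicalModel_exists_printed)
      (F : HodgeCM.CMField) [IsGalois ℚ F] (h6 : 6 ≤ Module.finrank ℚ F) {ι₁ : F →+* ℂ} (V : HodgeCM.HermSpace3 F ι₁) (a₀ : RealScalar F)
      (Φ : CMType F) (hΦ : ι₁ ∈ Φ.1) (i : (I V (repAt a₀) (muLiu ι₁ GramClass.rep))),
      admissible_occursInH1 (((uniformOmegaRep (Summit.HodgeConjecture.CorCM.DelRec.exists_recordSystem_of_printed hDel) ⟨HodgeCM.CMField.K F⟩ ι₁ ⟨HodgeCM.HermSpace3.Hm V, HodgeCM.HermSpace3.isHermitian V, HodgeCM.HermSpace3.signature_ι₁ V, HodgeCM.HermSpace3.posDef_of_ne V⟩ Φ e₁ (frameD V) (frameD_real V) (frameD_ne V) (ιVE V) (2 * imagUnit (HodgeCM.CMField.K F))⁻¹ (fun _ _ => (Rep.update ↥(maximalRealSubfield (HodgeCM.CMField.K F)) (imagUnitSq (HodgeCM.CMField.K F)) (Rep.ofLineOf ↥(maximalRealSubfield (HodgeCM.CMField.K F)) (imagUnitSq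 (HodgeCM.CMField.K F))) (locF ↥(maximalRealSubfield (HodgeCM.CMField.K F)) (imagUnitSq (HodgeCM.CMField.K F)) (realUnit ⟨HodgeCM.CMField.K F⟩ (repAt a₀ (Sigma.fst i)).1 (repAt a₀ (Sigma.fst i)).2.1 (repAt a₀ (Sigma.fst i)).2.2)) (realUnit ⟨HodgeCM.CMField.K F⟩ (repAt a₀ (Sigma.fst i)).1 (repAt a₀ (Sigma.fst i)).2.1 (repAt a₀ (Sigma.fst i)).2.2) rfl)))).prop413Data ((liuDictionaryPin exists_isReal_hodgeModel_holds hodgePQ_independent_of_hodgeModel_holds BallQuotient.ballQuotientUniformised_holds (cmAbelianVarietyRealised_of_eigenbasis exists_isReal_hodgeModel_holds hodgePQ_independent_of_hodgeModel_holds cmAbelianVarietyEigenbasisRealised_holds) Literature.NumberTheory.Transcendental.arapura2012_cor_15_4_6_holds V (I V (repAt a₀) (muLiu ι₁ GramClass.rep)) (line V (repAt a₀) (muLiu ι₁ GramClass.rep)))).H)) :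
    Summit.HodgeConjecture.HodgeConjecture.Theses.HCCMUnconditional.H413 :=
  HJ3aOfFiveLetters.H413_of_five_letters hE1 hE1'h hE2' hDh F0P2aCohIsotypicLineHolds.cohIsotypicLine_hol_holds hdictE hocc

end Summit.HodgeConjecture.HodgeConjecture.Cruxes.H413.HJ3aOfFourLetters

end
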